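import Literature.NumberTheory.Automorphic.AdelicPiSchwartzBruhatFourier
import Mathlib.LinearAlgebra.DirectSum.Finsupp
import Mathlib.RepresentationTheory.Basic
import HarnessLib

/-!
# `𝒮(𝔸_K^ι) = 𝒮((K ⊗ ℝ)^ι) ⊗_ℂ 𝒮((𝔸_{K,f})^ι)` and the adelic action of a product of groups

The tree's adelic Schwartz–Bruhat space `piSchwartzBruhat K ι ⊆ (𝔸_K^ι → ℂ)`
(`AdelicPiSchwartzBruhatFourier`: the `ℂ`-span of the factorizable functions
`v ↦ Φ_∞(v_∞) Φ_f(v_f)`, `Φ_∞` a Schwartz function on `(K ⊗ ℝ)^ι`, `Φ_f` Schwartz–Bruhat on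
`(𝔸_{K,f})^ι`) IS the algebraic tensor product of the archimedean Schwartz space and the finite-adelic
Schwartz–Bruhat space:

* `TensorFunctions.mulMap_injective` — for `k`-linear INJECTIONS `ιA : A → (X → k)`, `ιB : B → (Y → k)`
  into function spaces over a field, the multiplication map `A ⊗[k] B → (X × Y → k)`,
  `a ⊗ b ↦ ((x, y) ↦ ιA a x · ιB b y)`, is injective (expand along a basis of `B`; linear independence
  pointwise in `x`);
* `adelicTensorMap K ι : 𝓢((ι → mixedSpace K), ℂ) ⊗[ℂ] 𝒮((𝔸_{K,f})^ι) →ₗ (𝔸_K^ι → ℂ)`,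
  `Φ_∞ ⊗ Φ_f ↦ (v ↦ Φ_∞(piArch v) Φ_f(piFinite v))`, is injective (`adelicTensorMap_injective`, through
  the tree's splitting `piAdeleSplit : (K ⊗ ℝ)^ι × (𝔸_{K,f})^ι ≃ 𝔸_K^ι`) with range exactly
  `piSchwartzBruhat K ι` (`range_adelicTensorMap`);
* `piSchwartzBruhatEquiv K ι : 𝓢((ι → mixedSpace K), ℂ) ⊗[ℂ] 𝒮((𝔸_{K,f})^ι) ≃ₗ[ℂ] piSchwartzBruhat K ι`
  (`coe_piSchwartzBruhatEquiv_tmul`).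

Consequently a pair of representations `ω_∞ : G_∞ → GL(𝓢((K ⊗ ℝ)^ι))`, `ω_f : G_f → GL(𝒮((𝔸_{K,f})^ι))`
defines THE ADELIC REPRESENTATION of `G_∞ × G_f` on `piSchwartzBruhat K ι`
(`adelicRep ω_∞ ω_f := ` transport of Mathlib's `Representation.tprod` along `piSchwartzBruhatEquiv`),
acting on factorizable functions factor by factor (`adelicRep_apply_tmul`, `coe_adelicRep_apply_tensor`):

  `ω(g_∞, g_f) (Φ_∞ ⊗ Φ_f) = (ω_∞(g_∞) Φ_∞) ⊗ (ω_f(g_f) Φ_f)`.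

This is the carrier-level glue `S(X(𝔸)) = S(X_∞) ⊗ S(X(𝔸_f))` of the global Weil representation
(Weil 1964 n° 29, 37–39: the adelic "standard" functions and the product action; Tate's thesis §3.2,
§4.2); with `𝒮((𝔸_{K,f})^ι) = ⊗'_v 𝒮(K_v^ι)` (`FiniteAdeleSchwartzBruhatTensor`) it exhibits
`piSchwartzBruhat K ι` as `𝒮_∞ ⊗ ⊗'_{v ∤ ∞} 𝒮(K_v^ι)`.

Everything in this file is proved (kernel); no cited fact is used.

## References

* [Weil1964] A. Weil, Sur certains groupes d'opérateurs unitaires, Acta Math. 111 (1964), n° 29, 37–39.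
* [TateThesis1967] J. Tate, Fourier analysis in number fields and Hecke's zeta-functions, §3.2, §4.2.
* [Bump1997] D. Bump, Automorphic forms and representations, §3.5.
-/

noncomputable section

open NumberField NumberField.mixedEmbedding NumberField.InfinitePlace IsDedekindDomain TensorProduct
  Function

open scoped SchwartzMap TensorProduct Classical

namespace Literature.NumberTheory.Automorphic

/-! ### Tensor products of function spaces embed into functions on the product -/

namespace TensorFunctions

universe uk uX uY uA uB

variable {k : Type uk} [Field k] {X : Type uX} {Y : Type uY} {A : Type uA} {B : Type uB}
  [AddCommGroup A] [Module k A] [AddCommGroup B] [Module k B]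
  (ιA : A →ₗ[k] (X → k)) (ιB : B →ₗ[k] (Y → k))

/-- The **multiplication map** `A ⊗[k] B → (X × Y → k)`, `a ⊗ b ↦ ((x, y) ↦ ιA a x · ιB b y)`, for linear
maps `ιA : A → (X → k)`, `ιB : B → (Y → k)` into function spaces. [folklore] -/
def mulMap : A ⊗[k] B →ₗ[k] (X × Y → k) :=
  TensorProduct.lift (LinearMap.mk₂ k (fun a b => fun p : X × Y => ιA a p.1 * ιB b p.2)
    (fun a a' b => by funext p; simp [add_mul])
    (fun c a b => by funext p; simp [mul_assoc])
    (fun a b b' => by funext p; simp [mul_add])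
    (fun c a b => by funext p; simp [mul_left_comm]))

/-- `mulMap (a ⊗ b) (x, y) = ιA a x * ιB b y`. [folklore] -/
@[simp] theorem mulMap_tmul (a : A) (b : B) :
    mulMap ιA ιB (a ⊗ₜ b) = fun p : X × Y => ιA a p.1 * ιB b p.2 :=
  TensorProduct.lift.tmul _ _

/-- **Injectivity of `A ⊗ B → (X × Y → k)`** for injections `ιA`, `ιB` into function spaces over a
field: expand an element of `A ⊗ B` along a basis `(b_κ)` of `B` as `Σ_κ a_κ ⊗ b_κ`; if the function
`(x, y) ↦ Σ_κ ιA a_κ x · ιB b_κ y` vanishes then for each `x` the element `Σ_κ (ιA a_κ x) • b_κ ∈ B` maps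
to `0`, so all `ιA a_κ x = 0` by linear independence, whence all `a_κ = 0`. [folklore] -/
theorem mulMap_injective (hA : Function.Injective ιA) (hB : Function.Injective ιB) :
    Function.Injective (mulMap ιA ιB) := by
  classical
  let bB := Module.Free.chooseBasis k B
  let e : A ⊗[k] B ≃ₗ[k] (Module.Free.ChooseBasisIndex k B →₀ A) :=
    (TensorProduct.congr (LinearEquiv.refl k A) bB.repr).trans
      (finsuppScalarRight k k A (Module.Free.ChooseBasisIndex k B))
  have he : ∀ (i : Module.Free.ChooseBasisIndex k B) (a : A),
      e.symm (Finsupp.single i a) = a ⊗ₜ bB i := by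
    intro i a
    simp [e, finsuppScalarRight_symm_apply_single]
  rw [injective_iff_map_eq_zero]
  intro t ht
  obtain ⟨f, rfl⟩ : ∃ f, e.symm f = t := ⟨e t, e.symm_apply_apply t⟩
  have hexp : mulMap ιA ιB (e.symm f) =
      fun p => ∑ i ∈ f.support, ιA (f i) p.1 * ιB (bB i) p.2 := by
    conv_lhs => rw [← Finsupp.sum_single f]
    rw [Finsupp.sum, map_sum, map_sum]
    funext p
    rw [Finset.sum_apply]
    refine Finset.sum_congr rfl fun i _ => ?_
    rw [he, mulMap_tmul]
  have hzero : ∀ x, ∑ i ∈ f.support, ιA (f i) x • bB i = 0 := by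
    intro x
    apply hB
    rw [map_sum, map_zero]
    funext y
    have h := congr_fun ht (x, y)
    rw [hexp] at h
    simpa [Finset.sum_apply] using h
  have hcoef : ∀ x, ∀ i ∈ f.support, ιA (f i) x = 0 := fun x =>
    linearIndependent_iff'.mp bB.linearIndependent f.support (fun i => ιA (f i) x) (hzero x)
  have hf : f = 0 :=
    Finsupp.support_eq_empty.mp (Finset.eq_empty_of_forall_notMem fun i hi =>
      (Finsupp.mem_support_iff.mp hi) (hA (by
        rw [map_zero]
        funext x
        exact hcoef x i hi)))
  rw [hf, map_zero]

/-- The range of `mulMap` is the span of the products `ιA a · ιB b`. [folklore] -/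
theorem range_mulMap :
    LinearMap.range (mulMap ιA ιB) =
      Submodule.span k {F | ∃ a b, F = fun p : X × Y => ιA a p.1 * ιB b p.2} := by
  apply le_antisymm
  · rintro _ ⟨t, rfl⟩
    induction t using TensorProduct.induction_on with
    | zero => rw [map_zero]; exact zero_mem _
    | tmul a b => exact Submodule.subset_span ⟨a, b, mulMap_tmul ιA ιB a b⟩
    | add s t hs ht => rw [map_add]; exact add_mem hs ht
  · rw [Submodule.span_le]
    rintro F ⟨a, b, rfl⟩
    exact ⟨a ⊗ₜ b, mulMap_tmul ιA ιB a b⟩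

end TensorFunctions

/-! ### Transport of a representation along a linear isomorphism -/

section Transport

universe uk uG uV uW

variable {k : Type uk} [CommSemiring k] {G : Type uG} [Monoid G] {V : Type uV} {W : Type uW}
  [AddCommMonoid V] [Module k V] [AddCommMonoid W] [Module k W]

/-- Transport of a representation along a linear isomorphism: `g ↦ e ∘ ρ(g) ∘ e⁻¹`. [folklore] -/
def Representation.congr (e : V ≃ₗ[k] W) (ρ : Representation k G V) : Representation k G W where
  toFun g := e.toLinearMap ∘ₗ ρ g ∘ₗ e.symm.toLinearMap
  map_one' := by
    ext w
    simp
  map_mul' g h := by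
    ext w
    simp

/-- `congr e ρ g w = e (ρ g (e⁻¹ w))`. [folklore] -/
@[simp] theorem Representation.congr_apply (e : V ≃ₗ[k] W) (ρ : Representation k G V) (g : G)
    (w : W) : Representation.congr e ρ g w = e (ρ g (e.symm w)) := rfl

/-- `congr e ρ g (e v) = e (ρ g v)`. [folklore] -/
theorem Representation.congr_apply_apply (e : V ≃ₗ[k] W) (ρ : Representation k G V) (g : G)
    (v : V) : Representation.congr e ρ g (e v) = e (ρ g v) := by
  rw [Representation.congr_apply, e.symm_apply_apply]

end Transport

/-! ### The adelic Schwartz–Bruhat space as `𝒮_∞ ⊗ 𝒮_f` -/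

section Adelic

variable (K : Type) [Field K] [NumberField K] (ι : Type) [Fintype ι]

/-- The coercion `𝓢((ι → K ⊗ ℝ), ℂ) → ((ι → K ⊗ ℝ) → ℂ)` as a `ℂ`-linear map. [folklore] -/
def schwartzCoeLM : 𝓢((ι → mixedSpace K), ℂ) →ₗ[ℂ] ((ι → mixedSpace K) → ℂ) where
  toFun Φ := ⇑Φ
  map_add' _ _ := rfl
  map_smul' _ _ := rfl

/-- `schwartzCoeLM Φ = ⇑Φ`. [folklore] -/
@[simp] theorem schwartzCoeLM_apply (Φ : 𝓢((ι → mixedSpace K), ℂ)) :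
    schwartzCoeLM K ι Φ = ⇑Φ := rfl

/-- The coercion of Schwartz maps is injective. [folklore] -/
theorem schwartzCoeLM_injective : Function.Injective (schwartzCoeLM K ι) :=
  fun Φ Ψ h => DFunLike.coe_injective (by simpa only [schwartzCoeLM_apply] using h)

/-- **The tensor-to-function map** `𝓢((K ⊗ ℝ)^ι) ⊗_ℂ 𝒮((𝔸_{K,f})^ι) → (𝔸_K^ι → ℂ)`,
`Φ_∞ ⊗ Φ_f ↦ (v ↦ Φ_∞(v_∞) Φ_f(v_f))` (`piArch`, `piFinite` of the tree). (Weil 1964, n° 29; Tate 1967,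
§3.2: the standard functions on the adeles.) [folklore] -/
def adelicTensorMap :
    𝓢((ι → mixedSpace K), ℂ) ⊗[ℂ] ↥(SchwartzBruhat (ι → FiniteAdeleRing (𝓞 K) K)) →ₗ[ℂ]
      ((ι → AdeleRing (𝓞 K) K) → ℂ) :=
  LinearMap.funLeft ℂ ℂ (fun v => (piArch K ι v, piFinite K ι v)) ∘ₗ
    TensorFunctions.mulMap (schwartzCoeLM K ι)
      (SchwartzBruhat (ι → FiniteAdeleRing (𝓞 K) K)).subtype

/-- On pure tensors: `adelicTensorMap (Φ_∞ ⊗ Φ_f) = (v ↦ Φ_∞(piArch v) Φ_f(piFinite v))`. [folklore] -/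
@[simp] theorem adelicTensorMap_tmul (Φinf : 𝓢((ι → mixedSpace K), ℂ))
    (Φfin : ↥(SchwartzBruhat (ι → FiniteAdeleRing (𝓞 K) K))) :
    adelicTensorMap K ι (Φinf ⊗ₜ Φfin) =
      fun v => Φinf (piArch K ι v) * (Φfin : (ι → FiniteAdeleRing (𝓞 K) K) → ℂ) (piFinite K ι v) := by
  simp only [adelicTensorMap, LinearMap.comp_apply, TensorFunctions.mulMap_tmul]
  rfl

/-- **`𝒮_∞ ⊗ 𝒮_f → (𝔸_K^ι → ℂ)` is injective.** [folklore] -/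
theorem adelicTensorMap_injective : Function.Injective (adelicTensorMap K ι) := by
  have hs : Function.Surjective
      (fun v : ι → AdeleRing (𝓞 K) K => (piArch K ι v, piFinite K ι v)) := fun p =>
    ⟨piAdeleSplit K ι p, by
      show (piArch K ι _, piFinite K ι _) = p
      rw [← piAdeleSplit_symm_apply, ContinuousAddEquiv.symm_apply_apply]⟩
  unfold adelicTensorMap
  rw [LinearMap.coe_comp]
  exact (LinearMap.funLeft_injective_of_surjective ℂ ℂ _ hs).comp
    (TensorFunctions.mulMap_injective _ _ (schwartzCoeLM_injective K ι)
      (SchwartzBruhat (ι → FiniteAdeleRing (𝓞 K) K)).injective_subtype)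

/-- **The range of `𝒮_∞ ⊗ 𝒮_f → (𝔸_K^ι → ℂ)` is the adelic Schwartz–Bruhat space** `piSchwartzBruhat`
(by its definition as the span of the factorizable functions). [folklore] -/
theorem range_adelicTensorMap : LinearMap.range (adelicTensorMap K ι) = piSchwartzBruhat K ι := by
  apply le_antisymm
  · rintro _ ⟨t, rfl⟩
    induction t using TensorProduct.induction_on with
    | zero => rw [map_zero]; exact zero_mem _
    | tmul a b => rw [adelicTensorMap_tmul]; exact tensor_mem_piSchwartzBruhat a b.2
    | add s t hs ht => rw [map_add]; exact add_mem hs ht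
  · rw [piSchwartzBruhat, Submodule.span_le]
    rintro Φ ⟨Φinf, Φfin, hfin, rfl⟩
    exact ⟨Φinf ⊗ₜ ⟨Φfin, hfin⟩, adelicTensorMap_tmul K ι Φinf ⟨Φfin, hfin⟩⟩

/-- **`𝒮(𝔸_K^ι) ≅ 𝒮((K ⊗ ℝ)^ι) ⊗_ℂ 𝒮((𝔸_{K,f})^ι)`**: the linear isomorphism from the algebraic
tensor product onto the tree's adelic Schwartz–Bruhat space `piSchwartzBruhat K ι`. (Weil 1964, n° 29;
Tate 1967, §3.2, §4.2; Bump 1997, §3.5.) [folklore] -/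
def piSchwartzBruhatEquiv :
    𝓢((ι → mixedSpace K), ℂ) ⊗[ℂ] ↥(SchwartzBruhat (ι → FiniteAdeleRing (𝓞 K) K)) ≃ₗ[ℂ]
      ↥(piSchwartzBruhat K ι) :=
  (LinearEquiv.ofInjective _ (adelicTensorMap_injective K ι)).trans
    (LinearEquiv.ofEq _ _ (range_adelicTensorMap K ι))

/-- Underlying function of `piSchwartzBruhatEquiv t` is `adelicTensorMap t`. [folklore] -/
@[simp] theorem coe_piSchwartzBruhatEquiv
    (t : 𝓢((ι → mixedSpace K), ℂ) ⊗[ℂ] ↥(SchwartzBruhat (ι → FiniteAdeleRing (𝓞 K) K))) :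
    ((piSchwartzBruhatEquiv K ι t : ↥(piSchwartzBruhat K ι)) : (ι → AdeleRing (𝓞 K) K) → ℂ) =
      adelicTensorMap K ι t := rfl

/-- On pure tensors `piSchwartzBruhatEquiv (Φ_∞ ⊗ Φ_f)` is the factorizable function
`v ↦ Φ_∞(v_∞) Φ_f(v_f)`. [folklore] -/
theorem coe_piSchwartzBruhatEquiv_tmul (Φinf : 𝓢((ι → mixedSpace K), ℂ))
    (Φfin : ↥(SchwartzBruhat (ι → FiniteAdeleRing (𝓞 K) K))) :
    ((piSchwartzBruhatEquiv K ι (Φinf ⊗ₜ Φfin) : ↥(piSchwartzBruhat K ι)) :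
        (ι → AdeleRing (𝓞 K) K) → ℂ) =
      fun v => Φinf (piArch K ι v) * (Φfin : (ι → FiniteAdeleRing (𝓞 K) K) → ℂ) (piFinite K ι v) := by
  rw [coe_piSchwartzBruhatEquiv, adelicTensorMap_tmul]

/-- Every element of `piSchwartzBruhat` is the image of a (unique) tensor. [folklore] -/
theorem piSchwartzBruhatEquiv_symm_tensor (Φinf : 𝓢((ι → mixedSpace K), ℂ))
    {Φfin : (ι → FiniteAdeleRing (𝓞 K) K) → ℂ}
    (hfin : Φfin ∈ SchwartzBruhat (ι → FiniteAdeleRing (𝓞 K) K)) :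
    (piSchwartzBruhatEquiv K ι).symm ⟨_, tensor_mem_piSchwartzBruhat Φinf hfin⟩ =
      Φinf ⊗ₜ ⟨Φfin, hfin⟩ := by
  apply (piSchwartzBruhatEquiv K ι).injective
  rw [LinearEquiv.apply_symm_apply]
  apply Subtype.ext
  rw [coe_piSchwartzBruhatEquiv_tmul]

/-! ### Tensor-product operators and representations on `𝒮(𝔸_K^ι)` -/

variable {K ι}

/-- Abbreviation: the finite-adelic Schwartz–Bruhat space `𝒮((𝔸_{K,f})^ι)` as a type. [folklore] -/
abbrev FinSB (K : Type) [Field K] [NumberField K] (ι : Type) : Type :=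
  ↥(SchwartzBruhat (ι → FiniteAdeleRing (𝓞 K) K))

/-- **Tensor product of operators** `A ⊗ B` acting on `𝒮(𝔸_K^ι) = piSchwartzBruhat K ι`, for linear
operators `A` on `𝓢((K ⊗ ℝ)^ι)` and `B` on `𝒮((𝔸_{K,f})^ι)`: the conjugate of `TensorProduct.map A B`
by `piSchwartzBruhatEquiv`. [folklore] -/
def adelicTensorEnd (A : 𝓢((ι → mixedSpace K), ℂ) →ₗ[ℂ] 𝓢((ι → mixedSpace K), ℂ))
    (B : FinSB K ι →ₗ[ℂ] FinSB K ι) : Module.End ℂ ↥(piSchwartzBruhat K ι) :=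
  (piSchwartzBruhatEquiv K ι).toLinearMap ∘ₗ TensorProduct.map A B ∘ₗ
    (piSchwartzBruhatEquiv K ι).symm.toLinearMap

/-- `(A ⊗ B)(Φ_∞ ⊗ Φ_f) = A Φ_∞ ⊗ B Φ_f`. [folklore] -/
theorem adelicTensorEnd_apply_tmul (A : 𝓢((ι → mixedSpace K), ℂ) →ₗ[ℂ] 𝓢((ι → mixedSpace K), ℂ))
    (B : FinSB K ι →ₗ[ℂ] FinSB K ι) (Φinf : 𝓢((ι → mixedSpace K), ℂ)) (Φfin : FinSB K ι) :
    adelicTensorEnd A B (piSchwartzBruhatEquiv K ι (Φinf ⊗ₜ Φfin)) =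
      piSchwartzBruhatEquiv K ι (A Φinf ⊗ₜ B Φfin) := by
  simp only [adelicTensorEnd, LinearMap.comp_apply, LinearEquiv.coe_toLinearMap,
    LinearEquiv.symm_apply_apply, TensorProduct.map_tmul]

/-- `(A ⊗ B)` on a factorizable function, as a function:
`(A ⊗ B)(Φ_∞ ⊗ Φ_f)(v) = (A Φ_∞)(v_∞) · (B Φ_f)(v_f)`. [folklore] -/
theorem coe_adelicTensorEnd_apply_tensor (A : 𝓢((ι → mixedSpace K), ℂ) →ₗ[ℂ] 𝓢((ι → mixedSpace K), ℂ))
    (B : FinSB K ι →ₗ[ℂ] FinSB K ι) (Φinf : 𝓢((ι → mixedSpace K), ℂ))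
    {Φfin : (ι → FiniteAdeleRing (𝓞 K) K) → ℂ}
    (hfin : Φfin ∈ SchwartzBruhat (ι → FiniteAdeleRing (𝓞 K) K)) :
    ((adelicTensorEnd A B ⟨_, tensor_mem_piSchwartzBruhat Φinf hfin⟩ : ↥(piSchwartzBruhat K ι)) :
        (ι → AdeleRing (𝓞 K) K) → ℂ) =
      fun v => A Φinf (piArch K ι v) *
        ((B ⟨Φfin, hfin⟩ : FinSB K ι) : (ι → FiniteAdeleRing (𝓞 K) K) → ℂ) (piFinite K ι v) := by
  have h : (⟨_, tensor_mem_piSchwartzBruhat Φinf hfin⟩ : ↥(piSchwartzBruhat K ι)) =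
      piSchwartzBruhatEquiv K ι (Φinf ⊗ₜ ⟨Φfin, hfin⟩) :=
    Subtype.ext (coe_piSchwartzBruhatEquiv_tmul K ι Φinf ⟨Φfin, hfin⟩).symm
  rw [h, adelicTensorEnd_apply_tmul, coe_piSchwartzBruhatEquiv_tmul]

/-- `1 ⊗ 1 = 1`. [folklore] -/
theorem adelicTensorEnd_one : adelicTensorEnd (K := K) (ι := ι) 1 1 = 1 := by
  apply LinearMap.ext
  intro Ψ
  simp only [adelicTensorEnd, TensorProduct.map_one, LinearMap.comp_apply, LinearEquiv.coe_toLinearMap,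
    Module.End.one_apply, LinearEquiv.apply_symm_apply]

/-- `id ⊗ id = id`. [folklore] -/
theorem adelicTensorEnd_id : adelicTensorEnd (K := K) (ι := ι) LinearMap.id LinearMap.id = LinearMap.id :=
  adelicTensorEnd_one

/-- `(A A') ⊗ (B B') = (A ⊗ B)(A' ⊗ B')`. [folklore] -/
theorem adelicTensorEnd_mul (A A' : 𝓢((ι → mixedSpace K), ℂ) →ₗ[ℂ] 𝓢((ι → mixedSpace K), ℂ))
    (B B' : FinSB K ι →ₗ[ℂ] FinSB K ι) :
    adelicTensorEnd (A * A') (B * B') = adelicTensorEnd A B * adelicTensorEnd A' B' := by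
  apply LinearMap.ext
  intro Ψ
  simp only [adelicTensorEnd, TensorProduct.map_mul, Module.End.mul_apply, LinearMap.comp_apply,
    LinearEquiv.coe_toLinearMap, LinearEquiv.symm_apply_apply]

/-- `(A ∘ A') ⊗ (B ∘ B') = (A ⊗ B) ∘ (A' ⊗ B')`. [folklore] -/
theorem adelicTensorEnd_comp (A A' : 𝓢((ι → mixedSpace K), ℂ) →ₗ[ℂ] 𝓢((ι → mixedSpace K), ℂ))
    (B B' : FinSB K ι →ₗ[ℂ] FinSB K ι) :
    adelicTensorEnd (A ∘ₗ A') (B ∘ₗ B') = adelicTensorEnd A B ∘ₗ adelicTensorEnd A' B' :=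
  adelicTensorEnd_mul A A' B B'

/-- `adelicTensorEnd` is determined by, and computes on, the spanning factorizable functions: two linear
endomorphisms of `piSchwartzBruhat` agreeing on all `Φ_∞ ⊗ Φ_f` are equal. [folklore] -/
theorem linearMap_ext_tensor {M : Type*} [AddCommMonoid M] [Module ℂ M]
    {F₁ F₂ : ↥(piSchwartzBruhat K ι) →ₗ[ℂ] M}
    (h : ∀ (Φinf : 𝓢((ι → mixedSpace K), ℂ)) (Φfin : FinSB K ι),
      F₁ (piSchwartzBruhatEquiv K ι (Φinf ⊗ₜ Φfin)) = F₂ (piSchwartzBruhatEquiv K ι (Φinf ⊗ₜ Φfin))) :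
    F₁ = F₂ := by
  have h' : F₁ ∘ₗ (piSchwartzBruhatEquiv K ι).toLinearMap =
      F₂ ∘ₗ (piSchwartzBruhatEquiv K ι).toLinearMap :=
    TensorProduct.ext' fun Φinf Φfin => h Φinf Φfin
  have := congrArg (fun F => F ∘ₗ (piSchwartzBruhatEquiv K ι).symm.toLinearMap) h'
  simpa [LinearMap.comp_assoc] using this

variable {G : Type*} [Monoid G] {Ginf : Type*} {Gfin : Type*} [Monoid Ginf] [Monoid Gfin]

/-- **Tensor product representation** on `𝒮(𝔸_K^ι) = piSchwartzBruhat K ι` of representations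
`π_∞` of `G` on `𝓢((K ⊗ ℝ)^ι)` and `π_f` of `G` on `𝒮((𝔸_{K,f})^ι)`: Mathlib's `Representation.tprod`
transported along `piSchwartzBruhatEquiv`. [folklore] -/
def adelicTensorRep (πinf : Representation ℂ G 𝓢((ι → mixedSpace K), ℂ))
    (πfin : Representation ℂ G (FinSB K ι)) : Representation ℂ G ↥(piSchwartzBruhat K ι) :=
  Representation.congr (piSchwartzBruhatEquiv K ι) (Representation.tprod πinf πfin)

/-- `adelicTensorRep π_∞ π_f g = π_∞(g) ⊗ π_f(g)` (`adelicTensorEnd`). [folklore] -/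
theorem adelicTensorRep_apply (πinf : Representation ℂ G 𝓢((ι → mixedSpace K), ℂ))
    (πfin : Representation ℂ G (FinSB K ι)) (g : G) :
    adelicTensorRep πinf πfin g = adelicTensorEnd (πinf g) (πfin g) := by
  apply LinearMap.ext
  intro Ψ
  simp only [adelicTensorRep, Representation.congr_apply, Representation.tprod_apply, adelicTensorEnd,
    LinearMap.comp_apply, LinearEquiv.coe_toLinearMap]

/-- **Action on pure tensors**: `(π_∞ ⊗ π_f)(g)(Φ_∞ ⊗ Φ_f) = π_∞ g Φ_∞ ⊗ π_f g Φ_f`. [folklore] -/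
theorem adelicTensorRep_apply_tmul (πinf : Representation ℂ G 𝓢((ι → mixedSpace K), ℂ))
    (πfin : Representation ℂ G (FinSB K ι)) (g : G) (Φinf : 𝓢((ι → mixedSpace K), ℂ))
    (Φfin : FinSB K ι) :
    adelicTensorRep πinf πfin g (piSchwartzBruhatEquiv K ι (Φinf ⊗ₜ Φfin)) =
      piSchwartzBruhatEquiv K ι (πinf g Φinf ⊗ₜ πfin g Φfin) := by
  rw [adelicTensorRep_apply, adelicTensorEnd_apply_tmul]

/-- Action on factorizable functions, as functions. [folklore] -/
theorem coe_adelicTensorRep_apply_tensor (πinf : Representation ℂ G 𝓢((ι → mixedSpace K), ℂ))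
    (πfin : Representation ℂ G (FinSB K ι)) (g : G) (Φinf : 𝓢((ι → mixedSpace K), ℂ))
    {Φfin : (ι → FiniteAdeleRing (𝓞 K) K) → ℂ}
    (hfin : Φfin ∈ SchwartzBruhat (ι → FiniteAdeleRing (𝓞 K) K)) :
    ((adelicTensorRep πinf πfin g ⟨_, tensor_mem_piSchwartzBruhat Φinf hfin⟩ : ↥(piSchwartzBruhat K ι)) :
        (ι → AdeleRing (𝓞 K) K) → ℂ) =
      fun v => πinf g Φinf (piArch K ι v) *
        ((πfin g ⟨Φfin, hfin⟩ : FinSB K ι) : (ι → FiniteAdeleRing (𝓞 K) K) → ℂ) (piFinite K ι v) := by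
  rw [adelicTensorRep_apply, coe_adelicTensorEnd_apply_tensor]

/-! ### The adelic representation of `G_∞ × G_f` -/

/-- **The adelic representation** of `G_∞ × G_f` on `𝒮(𝔸_K^ι) = piSchwartzBruhat K ι` attached to
representations `ω_∞` of `G_∞` on `𝓢((K ⊗ ℝ)^ι)` and `ω_f` of `G_f` on `𝒮((𝔸_{K,f})^ι)`:
`adelicTensorRep (ω_∞ ∘ fst) (ω_f ∘ snd)`. (Weil 1964, n° 37–39: the adelic Weil representation is the
product of the local ones.) [folklore] -/
def adelicRep (ωinf : Representation ℂ Ginf 𝓢((ι → mixedSpace K), ℂ))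
    (ωfin : Representation ℂ Gfin (FinSB K ι)) :
    Representation ℂ (Ginf × Gfin) ↥(piSchwartzBruhat K ι) :=
  adelicTensorRep (ωinf.comp (MonoidHom.fst Ginf Gfin)) (ωfin.comp (MonoidHom.snd Ginf Gfin))

/-- `adelicRep ω_∞ ω_f (g_∞, g_f) = ω_∞(g_∞) ⊗ ω_f(g_f)`. [folklore] -/
theorem adelicRep_apply (ωinf : Representation ℂ Ginf 𝓢((ι → mixedSpace K), ℂ))
    (ωfin : Representation ℂ Gfin (FinSB K ι)) (g : Ginf × Gfin) :
    adelicRep ωinf ωfin g = adelicTensorEnd (ωinf g.1) (ωfin g.2) :=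
  adelicTensorRep_apply _ _ g

/-- **Action on pure tensors**: `ω(g_∞, g_f) (Φ_∞ ⊗ Φ_f) = (ω_∞ g_∞ Φ_∞) ⊗ (ω_f g_f Φ_f)`. [folklore] -/
theorem adelicRep_apply_tmul (ωinf : Representation ℂ Ginf 𝓢((ι → mixedSpace K), ℂ))
    (ωfin : Representation ℂ Gfin (FinSB K ι)) (g : Ginf × Gfin)
    (Φinf : 𝓢((ι → mixedSpace K), ℂ)) (Φfin : FinSB K ι) :
    adelicRep ωinf ωfin g (piSchwartzBruhatEquiv K ι (Φinf ⊗ₜ Φfin)) =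
      piSchwartzBruhatEquiv K ι (ωinf g.1 Φinf ⊗ₜ ωfin g.2 Φfin) :=
  adelicTensorRep_apply_tmul _ _ g Φinf Φfin

/-- **Action on factorizable functions, as functions**: for `Φ = Φ_∞ ⊗ Φ_f`,
`(ω(g_∞, g_f) Φ)(v) = (ω_∞ g_∞ Φ_∞)(v_∞) · (ω_f g_f Φ_f)(v_f)`. [folklore] -/
theorem coe_adelicRep_apply_tensor (ωinf : Representation ℂ Ginf 𝓢((ι → mixedSpace K), ℂ))
    (ωfin : Representation ℂ Gfin (FinSB K ι)) (g : Ginf × Gfin)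
    (Φinf : 𝓢((ι → mixedSpace K), ℂ)) {Φfin : (ι → FiniteAdeleRing (𝓞 K) K) → ℂ}
    (hfin : Φfin ∈ SchwartzBruhat (ι → FiniteAdeleRing (𝓞 K) K)) :
    ((adelicRep ωinf ωfin g ⟨_, tensor_mem_piSchwartzBruhat Φinf hfin⟩ : ↥(piSchwartzBruhat K ι)) :
        (ι → AdeleRing (𝓞 K) K) → ℂ) =
      fun v => ωinf g.1 Φinf (piArch K ι v) *
        ((ωfin g.2 ⟨Φfin, hfin⟩ : FinSB K ι) : (ι → FiniteAdeleRing (𝓞 K) K) → ℂ)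
          (piFinite K ι v) :=
  coe_adelicTensorRep_apply_tensor _ _ g Φinf hfin

/-- The archimedean factor alone acts by `ω_∞ ⊗ 1`. [folklore] -/
theorem adelicRep_inl_apply_tmul (ωinf : Representation ℂ Ginf 𝓢((ι → mixedSpace K), ℂ))
    (ωfin : Representation ℂ Gfin (FinSB K ι)) (g : Ginf)
    (Φinf : 𝓢((ι → mixedSpace K), ℂ)) (Φfin : FinSB K ι) :
    adelicRep ωinf ωfin (g, 1) (piSchwartzBruhatEquiv K ι (Φinf ⊗ₜ Φfin)) =
      piSchwartzBruhatEquiv K ι (ωinf g Φinf ⊗ₜ Φfin) := by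
  rw [adelicRep_apply_tmul, map_one, Module.End.one_apply]

/-- The finite factor alone acts by `1 ⊗ ω_f`. [folklore] -/
theorem adelicRep_inr_apply_tmul (ωinf : Representation ℂ Ginf 𝓢((ι → mixedSpace K), ℂ))
    (ωfin : Representation ℂ Gfin (FinSB K ι)) (g : Gfin)
    (Φinf : 𝓢((ι → mixedSpace K), ℂ)) (Φfin : FinSB K ι) :
    adelicRep ωinf ωfin (1, g) (piSchwartzBruhatEquiv K ι (Φinf ⊗ₜ Φfin)) =
      piSchwartzBruhatEquiv K ι (Φinf ⊗ₜ ωfin g Φfin) := by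
  rw [adelicRep_apply_tmul, map_one, Module.End.one_apply]

/-- The two factors commute: `ω(g_∞, 1) ω(1, g_f) = ω(1, g_f) ω(g_∞, 1) = ω(g_∞, g_f)`. [folklore] -/
theorem adelicRep_inl_mul_inr (ωinf : Representation ℂ Ginf 𝓢((ι → mixedSpace K), ℂ))
    (ωfin : Representation ℂ Gfin (FinSB K ι)) (ginf : Ginf) (gfin : Gfin) :
    adelicRep ωinf ωfin (ginf, 1) * adelicRep ωinf ωfin (1, gfin) =
      adelicRep ωinf ωfin (ginf, gfin) := by
  rw [← map_mul, Prod.mk_mul_mk, mul_one, one_mul]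

end Adelic

end Literature.NumberTheory.Automorphic

end
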